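import Mathlib.Analysis.Calculus.BumpFunction.InnerProduct
import Mathlib.Analysis.Calculus.FDeriv.Equiv
import Literature.Analysis.FluidPDE.VorticityCalculus
import Literature.Analysis.FluidPDE.VectorCalculusProofs
import HarnessLib

/-!
# Barrier: the strain / velocity gradient at a point is not controlled by the vorticity near that point

Barrier catalogue `Literature/Barriers/NavierStokesRegularity/` (D-0021), METHOD LEVEL, everything PROVED (zero
fact debt). Filed by the NS-CLAIMS sweep (D-0090, cell `ns-claims`, seat `ns-claims-salvage-p1`) as the LOCAL
companion of `SupNormCalderonZygmundFailure` (there: the GLOBAL sup-norm bound `‖∇U‖_∞ ≤ C sup‖curl U‖` fails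
by a logarithm). Here: NO pointwise or local law at all. The velocity gradient of a divergence-free field is a
SINGULAR-INTEGRAL functional of the vorticity (`∇v(x) = c ω(x) × · + PV∫ ∇K₃(x − y) ω(y) dy`, Majda–Bertozzi
§2.4.1–§2.4.3, Prop. 2.17), not a function of `ω` at or near `x`: a smooth, compactly supported, divergence-free
field can be exactly IRROTATIONAL on a ball and carry there a non-zero constant strain.

## The witness (the «strain cavity»)

`U = curl (η · A)`, `A(x) = x₂ (x₁, −x₀, 0)`, `η` a smooth bump `≡ 1` on the unit ball with `supp η ⊆ B(0,2)`:
`U ∈ C_c^∞(ℝ³; ℝ³)`, `div U = div curl = 0`, and on the unit ball `U(x) = curl A (x) = D x` with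
`D = diag(1, 1, −2)` — the axisymmetric irrotational strain: `∇U ≡ D ≠ 0`, `curl U ≡ 0` there
(`StrainCavity.cavity`, `fderiv_cavity`, `curl_cavity`). Dilating (`U(x/r)`) puts the irrotational core on any
ball `B(0, r)`. (The same field is the C86 kernel companion `Summit.….Theorems.Bledsoe2026.v` of
`Theorems/SoloRefuteBledsoe2026Fields.lean` (refuter-4), rebuilt here because Literature files do not import
Summits files.)

## Formal content (namespace `Literature.Barriers.NavierStokesRegularity.StrainCavity`)

* `exists_divFree_irrotational_core` — for every `r > 0`: `U ∈ C_c^∞`, `div U = 0`, `curl U = 0` and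
  `∇U = r⁻¹ D` on `B(0, r)`;
* `not_exists_pointwise_gradient_modulus` — there is NO function `F` with `F(0) ≤ 0` such that
  `‖∇U(x)‖ ≤ F(‖curl U(x)‖)` for all divergence-free `U ∈ C_c^∞` and all `x` (no pointwise law
  `|∇u| ≲ |ω|`, `|S| ≲ |ω|`, `|(ω·∇)u| …` driven by `|ω(x)|` alone);
* `not_exists_local_gradient_le_vorticity` — for NO `C` and NO radius `r > 0` does
  `‖∇U(x)‖ ≤ C · sup_{B(x,r)} ‖curl U‖` hold for all divergence-free `U ∈ C_c^∞`;
* `VorticityStrainNonlocality` (packaged, structured barrier block) and `…_holds`.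

Rows of the claims map it bears on (cite the locator, not the author): the T6 «vorticity-geometric» family — steps
that bound the stretching `(ω·∇)u`, the strain `S = ½(∇u + ∇uᵀ)` or `∇u` at a point by the vorticity at that point
or in a neighbourhood (e.g. «regions where `ω = 0` do not stretch», «`|∇u| ∼ |ω|`»); context entries
`VortexStretchingAprioriBounds` (time-dependent amplification), `SupNormCalderonZygmundFailure` (global sup-norm,
the BKM logarithm), `ScalingAudit` (amplitude/homogeneity counts).

## References

* A. J. Majda, A. L. Bertozzi, *Vorticity and Incompressible Flow* (CUP 2002), §2.4.1–§2.4.3 (the velocity gradient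
  from the vorticity is a singular integral operator plus a local term, Prop. 2.17; «the computation of `∇v`
  requires the use of the distribution derivatives … the identity stated above is not always correct», p. 71–72),
  §1.4 (strain flows, irrotational strain `diag(γ₁, γ₂, −(γ₁+γ₂))`, eq. (1.28)–(1.30)).

WHAT THIS IS NOT: not a claim about NS regularity or blow-up; not a claim about any author beyond the typed locator.
Vector calculus on `ℝ³`.
-/

noncomputable section

open Set Filter Topology Function Metric
open scoped ContDiff

namespace Literature.Barriers.NavierStokesRegularity.StrainCavity

open Literature.Analysis.FluidPDE

/-! ### The potential `A(x) = x₂ (x₁, −x₀, 0)` and the strain `D = diag(1,1,−2)` -/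

/-- Components of the Fréchet derivative of a field are derivatives of the components. [folklore] -/
private theorem fderiv_apply_coord {f : EuclideanSpace ℝ (Fin 3) → EuclideanSpace ℝ (Fin 3)}
    {x : EuclideanSpace ℝ (Fin 3)} (hf : DifferentiableAt ℝ f x) (h : EuclideanSpace ℝ (Fin 3)) (i : Fin 3) :
    fderiv ℝ f x h i = fderiv ℝ (fun y => f y i) x h := by
  have := ((EuclideanSpace.proj i : EuclideanSpace ℝ (Fin 3) →L[ℝ] ℝ).hasFDerivAt.comp x hf.hasFDerivAt).fderiv
  rw [show (fun y => f y i) = (EuclideanSpace.proj i : EuclideanSpace ℝ (Fin 3) →L[ℝ] ℝ) ∘ f from rfl, this]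
  rfl

/-- The axisymmetric irrotational strain `D = diag(1, 1, −2)` (Majda–Bertozzi §1.4, strain flows) as a
continuous linear map. [folklore] -/
def strainD : EuclideanSpace ℝ (Fin 3) →L[ℝ] EuclideanSpace ℝ (Fin 3) :=
  (EuclideanSpace.proj (0 : Fin 3) : EuclideanSpace ℝ (Fin 3) →L[ℝ] ℝ).smulRight (EuclideanSpace.single 0 1) +
  (EuclideanSpace.proj (1 : Fin 3) : EuclideanSpace ℝ (Fin 3) →L[ℝ] ℝ).smulRight (EuclideanSpace.single 1 1) -
  (2 : ℝ) • (EuclideanSpace.proj (2 : Fin 3) : EuclideanSpace ℝ (Fin 3) →L[ℝ] ℝ).smulRight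
    (EuclideanSpace.single 2 1)

/-- `D h = (h₀, h₁, −2h₂)`. [folklore] -/
private theorem strainD_apply (h : EuclideanSpace ℝ (Fin 3)) (k : Fin 3) : strainD h k = ![h 0, h 1, -2 * h 2] k := by
  fin_cases k <;> simp [strainD]

/-- `D e₀ = e₀`: the strain does not vanish (indeed `‖D‖ ≥ 1`). [folklore] -/
private theorem strainD_single_zero : strainD (EuclideanSpace.single 0 1) = EuclideanSpace.single 0 1 := by
  ext k
  rw [strainD_apply]
  fin_cases k <;> simp

/-- `‖D‖ ≥ 1`. [folklore] -/
private theorem one_le_norm_strainD : 1 ≤ ‖strainD‖ := by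
  have h := strainD.le_opNorm (EuclideanSpace.single 0 1)
  rw [strainD_single_zero] at h
  simpa using h

/-- A linear field has no curl iff its matrix is symmetric; `curl (D x) = 0`. [folklore] -/
private theorem curlCLM_strainD : curlCLM strainD = 0 := by
  have : curl (fun y => strainD y) 0 = 0 := by
    have h : fderiv ℝ (fun y => strainD y) 0 = strainD := strainD.fderiv
    ext k
    fin_cases k <;> simp [curl, h, strainD_apply]
  rwa [curl_eq_curlCLM, strainD.fderiv] at this

/-- The vector potential `A(x) = x₂ (x₁, −x₀, 0)` of the strain: `curl A = D x`. [folklore] -/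
def potA (x : EuclideanSpace ℝ (Fin 3)) : EuclideanSpace ℝ (Fin 3) := WithLp.toLp 2 ![x 2 * x 1, -(x 2 * x 0), 0]

/-- Calculus helper `potA_apply_zero` for the strain-cavity construction. [folklore] -/
private theorem potA_apply_zero (x : EuclideanSpace ℝ (Fin 3)) : potA x 0 = x 2 * x 1 := by simp [potA]
/-- Calculus helper `potA_apply_one` for the strain-cavity construction. [folklore] -/
private theorem potA_apply_one (x : EuclideanSpace ℝ (Fin 3)) : potA x 1 = -(x 2 * x 0) := by simp [potA]
/-- Calculus helper `potA_apply_two` for the strain-cavity construction. [folklore] -/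
private theorem potA_apply_two (x : EuclideanSpace ℝ (Fin 3)) : potA x 2 = 0 := by simp [potA]

/-- Calculus helper `contDiff_potA0` for the strain-cavity construction. [folklore] -/
private theorem contDiff_potA0 : ContDiff ℝ ∞ (fun x => potA x 0) := by
  rw [show (fun x => potA x 0) = fun x : EuclideanSpace ℝ (Fin 3) => x 2 * x 1 from funext potA_apply_zero]
  exact (EuclideanSpace.proj (2 : Fin 3) : EuclideanSpace ℝ (Fin 3) →L[ℝ] ℝ).contDiff.mul
    (EuclideanSpace.proj (1 : Fin 3) : EuclideanSpace ℝ (Fin 3) →L[ℝ] ℝ).contDiff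

/-- Calculus helper `contDiff_potA1` for the strain-cavity construction. [folklore] -/
private theorem contDiff_potA1 : ContDiff ℝ ∞ (fun x => potA x 1) := by
  rw [show (fun x => potA x 1) = fun x : EuclideanSpace ℝ (Fin 3) => -(x 2 * x 0) from funext potA_apply_one]
  exact ((EuclideanSpace.proj (2 : Fin 3) : EuclideanSpace ℝ (Fin 3) →L[ℝ] ℝ).contDiff.mul
    (EuclideanSpace.proj (0 : Fin 3) : EuclideanSpace ℝ (Fin 3) →L[ℝ] ℝ).contDiff).neg

/-- Calculus helper `contDiff_potA2` for the strain-cavity construction. [folklore] -/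
private theorem contDiff_potA2 : ContDiff ℝ ∞ (fun x => potA x 2) := by
  rw [show (fun x => potA x 2) = fun _ : EuclideanSpace ℝ (Fin 3) => (0 : ℝ) from funext potA_apply_two]
  exact contDiff_const

/-- `A` is smooth. [folklore] -/
private theorem potA_contDiff : ContDiff ℝ ∞ potA := by
  rw [contDiff_euclidean]
  intro i
  fin_cases i
  exacts [contDiff_potA0, contDiff_potA1, contDiff_potA2]

/-- `A` is differentiable. [folklore] -/
private theorem potA_differentiable : Differentiable ℝ potA := potA_contDiff.differentiable (by simp)

/-- Calculus helper `hasFDerivAt_potA0` for the strain-cavity construction. [folklore] -/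
private theorem hasFDerivAt_potA0 (x : EuclideanSpace ℝ (Fin 3)) : HasFDerivAt (fun y => potA y 0)
    (x 2 • (EuclideanSpace.proj 1 : EuclideanSpace ℝ (Fin 3) →L[ℝ] ℝ) +
      x 1 • (EuclideanSpace.proj 2 : EuclideanSpace ℝ (Fin 3) →L[ℝ] ℝ)) x :=
  ((EuclideanSpace.proj (2 : Fin 3) : EuclideanSpace ℝ (Fin 3) →L[ℝ] ℝ).hasFDerivAt.mul
    (EuclideanSpace.proj (1 : Fin 3) : EuclideanSpace ℝ (Fin 3) →L[ℝ] ℝ).hasFDerivAt).congr_of_eventuallyEq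
    (Eventually.of_forall fun y => potA_apply_zero y)

/-- Calculus helper `hasFDerivAt_potA1` for the strain-cavity construction. [folklore] -/
private theorem hasFDerivAt_potA1 (x : EuclideanSpace ℝ (Fin 3)) : HasFDerivAt (fun y => potA y 1)
    (-(x 2 • (EuclideanSpace.proj 0 : EuclideanSpace ℝ (Fin 3) →L[ℝ] ℝ) +
      x 0 • (EuclideanSpace.proj 2 : EuclideanSpace ℝ (Fin 3) →L[ℝ] ℝ))) x :=
  ((EuclideanSpace.proj (2 : Fin 3) : EuclideanSpace ℝ (Fin 3) →L[ℝ] ℝ).hasFDerivAt.mul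
    (EuclideanSpace.proj (0 : Fin 3) : EuclideanSpace ℝ (Fin 3) →L[ℝ] ℝ).hasFDerivAt).neg.congr_of_eventuallyEq
    (Eventually.of_forall fun y => potA_apply_one y)

/-- Calculus helper `hasFDerivAt_potA2` for the strain-cavity construction. [folklore] -/
private theorem hasFDerivAt_potA2 (x : EuclideanSpace ℝ (Fin 3)) :
    HasFDerivAt (fun y => potA y 2) (0 : EuclideanSpace ℝ (Fin 3) →L[ℝ] ℝ) x :=
  (hasFDerivAt_const (0 : ℝ) x).congr_of_eventuallyEq (Eventually.of_forall fun y => potA_apply_two y)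

/-- `curl A = D x`. [folklore] -/
private theorem curl_potA (x : EuclideanSpace ℝ (Fin 3)) : curl potA x = strainD x := by
  ext k
  fin_cases k
  · simp [curl, fderiv_apply_coord (potA_differentiable x), (hasFDerivAt_potA1 x).fderiv,
      (hasFDerivAt_potA2 x).fderiv, strainD_apply]
  · simp [curl, fderiv_apply_coord (potA_differentiable x), (hasFDerivAt_potA0 x).fderiv,
      (hasFDerivAt_potA2 x).fderiv, strainD_apply]
  · simp [curl, fderiv_apply_coord (potA_differentiable x), (hasFDerivAt_potA0 x).fderiv,
      (hasFDerivAt_potA1 x).fderiv, strainD_apply]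
    ring

/-! ### The strain cavity `U = curl (η · A)` -/

/-- The cut-off: a smooth bump `≡ 1` on the closed unit ball, supported in the ball of radius `2`. [folklore] -/
def η : ContDiffBump (0 : EuclideanSpace ℝ (Fin 3)) := ⟨1, 2, one_pos, one_lt_two⟩

/-- The compactly supported potential `Φ = η · A`. [folklore] -/
def potΦ (x : EuclideanSpace ℝ (Fin 3)) : EuclideanSpace ℝ (Fin 3) := (η : EuclideanSpace ℝ (Fin 3) → ℝ) x • potA x

/-- **The strain cavity** `U = curl (η · A)`: smooth, compactly supported, divergence free, equal to the
irrotational strain `D x` on the unit ball. [folklore] -/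
def cavity : EuclideanSpace ℝ (Fin 3) → EuclideanSpace ℝ (Fin 3) := curl potΦ

/-- `Φ` is smooth. [folklore] -/
private theorem potΦ_contDiff : ContDiff ℝ ∞ potΦ := η.contDiff.smul potA_contDiff

/-- `Φ` has compact support. [folklore] -/
private theorem potΦ_hasCompactSupport : HasCompactSupport potΦ :=
  η.hasCompactSupport.mono fun x hx => by
    contrapose! hx
    simp [potΦ, Function.notMem_support.1 hx]

/-- `U` is smooth. [folklore] -/
private theorem cavity_contDiff : ContDiff ℝ ∞ cavity :=
  contDiff_curl (n := ⊤) (potΦ_contDiff.of_le (by exact_mod_cast le_top))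

/-- `U` has compact support. [folklore] -/
private theorem cavity_hasCompactSupport : HasCompactSupport cavity := hasCompactSupport_curl potΦ_hasCompactSupport

/-- `div U = div curl Φ = 0`. [folklore] -/
private theorem cavity_isDivFree : VectorCalculus.IsDivFree cavity := fun x =>
  divergence_curl_eq_zero_holds potΦ (contDiff_infty.1 potΦ_contDiff 2) x

/-- On the open unit ball `U` agrees with the linear strain `D x` near every point. [folklore] -/
private theorem cavity_eventuallyEq {x : EuclideanSpace ℝ (Fin 3)} (hx : ‖x‖ < 1) :
    cavity =ᶠ[𝓝 x] fun y => strainD y := by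
  have hball : ∀ y : EuclideanSpace ℝ (Fin 3), ‖y‖ < 1 → cavity y = strainD y := by
    intro y hy
    have h : potΦ =ᶠ[𝓝 y] potA := by
      filter_upwards [Metric.isOpen_ball.mem_nhds (mem_ball_zero_iff.2 hy)] with z hz
      rw [potΦ, η.one_of_mem_closedBall (Metric.ball_subset_closedBall (by simpa [η] using hz)), one_smul]
    show curl potΦ y = strainD y
    rw [curl_eq_curlCLM, h.fderiv_eq, ← curl_eq_curlCLM, curl_potA]
  filter_upwards [Metric.isOpen_ball.mem_nhds (mem_ball_zero_iff.2 hx)] with y hy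
    using hball y (mem_ball_zero_iff.1 hy)

/-- On the open unit ball, `∇U = D`. [folklore] -/
private theorem fderiv_cavity {x : EuclideanSpace ℝ (Fin 3)} (hx : ‖x‖ < 1) : fderiv ℝ cavity x = strainD := by
  rw [(cavity_eventuallyEq hx).fderiv_eq]; exact strainD.fderiv

/-- On the open unit ball, `curl U = 0`. [folklore] -/
private theorem curl_cavity {x : EuclideanSpace ℝ (Fin 3)} (hx : ‖x‖ < 1) : curl cavity x = 0 := by
  rw [curl_eq_curlCLM, fderiv_cavity hx, curlCLM_strainD]

/-! ### Dilated cavities: the irrotational core on any ball -/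

/-- The dilated cavity `U_r(x) = U(x / r)`. [folklore] -/
def cavityR (r : ℝ) (x : EuclideanSpace ℝ (Fin 3)) : EuclideanSpace ℝ (Fin 3) := cavity (r⁻¹ • x)

/-- `∇U_r(x) = r⁻¹ ∇U(x/r)`. [folklore] -/
private theorem fderiv_cavityR (r : ℝ) (x : EuclideanSpace ℝ (Fin 3)) :
    fderiv ℝ (cavityR r) x = r⁻¹ • fderiv ℝ cavity (r⁻¹ • x) := by
  unfold cavityR
  exact fderiv_comp_smul r⁻¹

/-- **The irrotational core on every ball**: for each `r > 0` a smooth, compactly supported, divergence-free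
field on `ℝ³` whose curl vanishes on `B(0, r)` while its gradient there is the non-zero constant `r⁻¹ D`.
[cite: MajdaBertozziCUP2002, §2.4.1–§2.4.3 Prop. 2.17 (∇v is a singular integral of ω plus a local term)] -/
theorem exists_divFree_irrotational_core {r : ℝ} (hr : 0 < r) :
    ∃ U : EuclideanSpace ℝ (Fin 3) → EuclideanSpace ℝ (Fin 3),
      ContDiff ℝ ∞ U ∧ HasCompactSupport U ∧ VectorCalculus.IsDivFree U ∧
      (∀ x, ‖x‖ < r → curl U x = 0) ∧ (∀ x, ‖x‖ < r → fderiv ℝ U x = r⁻¹ • strainD) := by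
  have hr' : r⁻¹ ≠ 0 := inv_ne_zero hr.ne'
  have hin : ∀ x : EuclideanSpace ℝ (Fin 3), ‖x‖ < r → ‖r⁻¹ • x‖ < 1 := fun x hx => by
    rw [norm_smul, Real.norm_of_nonneg (inv_nonneg.2 hr.le), inv_mul_lt_iff₀ hr]; simpa using hx
  refine ⟨cavityR r, cavity_contDiff.comp (contDiff_id.const_smul _),
    cavity_hasCompactSupport.comp_smul hr', fun x => ?_, fun x hx => ?_, fun x hx => ?_⟩
  · rw [VectorCalculus.divergence, fderiv_cavityR]
    have h0 := cavity_isDivFree (r⁻¹ • x)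
    rw [VectorCalculus.divergence] at h0
    rw [ContinuousLinearMap.toLinearMap_smul, map_smul, h0, smul_zero]
  · rw [curl_eq_curlCLM, fderiv_cavityR, map_smul, fderiv_cavity (hin x hx), curlCLM_strainD, smul_zero]
  · rw [fderiv_cavityR, fderiv_cavity (hin x hx)]

/-! ### The barrier statements -/

/-- **No pointwise law: the velocity gradient is not a function of the vorticity at the same point.** There is
NO `F : ℝ → ℝ` with `F 0 ≤ 0` such that `‖∇U(x)‖ ≤ F(‖curl U(x)‖)` for every smooth compactly supported
divergence-free `U` and every `x` (the cavity has `curl U(0) = 0`, `‖∇U(0)‖ ≥ 1`).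
[cite: MajdaBertozziCUP2002, §2.4.1–§2.4.3 Prop. 2.17 (∇v is a singular integral of ω plus a local term)] -/
theorem not_exists_pointwise_gradient_modulus :
    ¬ ∃ F : ℝ → ℝ, F 0 ≤ 0 ∧ ∀ U : EuclideanSpace ℝ (Fin 3) → EuclideanSpace ℝ (Fin 3),
      ContDiff ℝ ∞ U → HasCompactSupport U → VectorCalculus.IsDivFree U →
        ∀ x, ‖fderiv ℝ U x‖ ≤ F ‖curl U x‖ := by
  rintro ⟨F, hF0, hF⟩
  obtain ⟨U, hU, hc, hdiv, hcurl, hD⟩ := exists_divFree_irrotational_core one_pos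
  have h := hF U hU hc hdiv 0
  rw [hcurl 0 (by simp), norm_zero, hD 0 (by simp), inv_one, one_smul] at h
  linarith [one_le_norm_strainD]

/-- **No local law either: the vorticity on a whole ball around `x` does not bound `∇U(x)`.** For NO constant
`C` and NO radius `r > 0` does `‖∇U(x)‖ ≤ C · sup_{‖y − x‖ < r} ‖curl U(y)‖` hold for all smooth compactly
supported divergence-free `U` (the dilated cavity is irrotational on `B(0, r)` with `∇U(0) = r⁻¹D ≠ 0`).
[cite: MajdaBertozziCUP2002, §2.4.1–§2.4.3 Prop. 2.17 (∇v is a singular integral of ω plus a local term)] -/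
theorem not_exists_local_gradient_le_vorticity :
    ¬ ∃ C r : ℝ, 0 < r ∧ ∀ U : EuclideanSpace ℝ (Fin 3) → EuclideanSpace ℝ (Fin 3),
      ContDiff ℝ ∞ U → HasCompactSupport U → VectorCalculus.IsDivFree U →
        ∀ (x : EuclideanSpace ℝ (Fin 3)) (M : ℝ), (∀ y, ‖y - x‖ < r → ‖curl U y‖ ≤ M) →
          ‖fderiv ℝ U x‖ ≤ C * M := by
  rintro ⟨C, r, hr, hC⟩
  obtain ⟨U, hU, hc, hdiv, hcurl, hD⟩ := exists_divFree_irrotational_core hr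
  have h := hC U hU hc hdiv 0 0 (fun y hy => by rw [hcurl y (by simpa using hy), norm_zero])
  rw [hD 0 (by simpa using hr), mul_zero, norm_smul, Real.norm_of_nonneg (inv_nonneg.2 hr.le)] at h
  have : 0 < r⁻¹ * ‖strainD‖ := mul_pos (inv_pos.2 hr) (lt_of_lt_of_le one_pos one_le_norm_strainD)
  linarith

/-- **Barrier: strain is not locally controlled by vorticity.** The conjunction of the two failures, each over
smooth compactly supported divergence-free fields on `ℝ³`: (1) no pointwise modulus `‖∇U(x)‖ ≤ F(‖curl U(x)‖)`
with `F(0) ≤ 0`; (2) no local bound `‖∇U(x)‖ ≤ C sup_{B(x,r)}‖curl U‖`, for any `C`, `r > 0`.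
technique_class: pointwise-strain-by-vorticity local-gradient-by-vorticity vortex-stretching-pointwise-bound
biot-savart-locality omega-zero-no-strain sup-strain-by-local-vorticity
blocks: steps for NavierStokesRegularity that bound `∇u`, the strain `S = ½(∇u + ∇uᵀ)`, or the stretching
`(ω·∇)u = Sω` at a point (or on a region) by the magnitude of `ω` at that point (or near it) — «`|∇u| ∼ |ω|`»,
«no stretching where the vorticity is small», «`|Sω·ω| ≤ C|ω|³` pointwise», local maximum-principle closures for
`|ω|²` that drop the nonlocal part of `S` [cite: MajdaBertozziCUP2002, §2.4.1–§2.4.3 Prop. 2.17 (∇v is a singular integral of ω plus a local term)].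
because: `∇u` is recovered from `ω` by an order-zero singular integral (Biot–Savart gradient,
`∇v(x) = cω(x)×· + PV∫∇K₃(x−y)ω(y)dy`), whose kernel sees all of `ℝ³`: the compactly supported divergence-free
«strain cavity» `curl(η·x₂(x₁,−x₀,0))` is exactly irrotational on a ball and carries there the constant strain
`diag(1,1,−2)` (kernel: `exists_divFree_irrotational_core`, `not_exists_pointwise_gradient_modulus`,
`not_exists_local_gradient_le_vorticity`); globally, only `L^p` (`1<p<∞`) / Hölder / `BMO`-with-log control
holds (`SupNormCalderonZygmundFailure`, Beale–Kato–Majda).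
evasions_known: (a) GLOBAL singular-integral bounds (`‖∇u‖_{L^p} ≤ C_p‖ω‖_{L^p}`, `1 < p < ∞`; BKM with the
logarithm of a higher norm); (b) special geometries where the nonlocal part is subordinate by structure
(2D, axisymmetric without swirl, genuinely one-directional vorticity — then the statement is about that class);
(c) integral identities (enstrophy production `∫ Sω·ω`) survive where pointwise bounds do not — but need global
information.
scope_caveats: (i) kinematic statement about smooth compactly supported fields; nothing about time evolution or
solutions of any PDE; (ii) the cavity is axisymmetric and irrotational only on a ball — it does not say that
vorticity and strain are independent globally (they are not: `‖S‖_{L²} = ‖ω‖_{L²}/√2` for decaying div-free fields).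
status: established (proved here; textbook kinematics)
[cite: MajdaBertozziCUP2002, §2.4.1–§2.4.3 Prop. 2.17 (∇v is a singular integral of ω plus a local term)] -/
def VorticityStrainNonlocality : Prop :=
  (¬ ∃ F : ℝ → ℝ, F 0 ≤ 0 ∧ ∀ U : EuclideanSpace ℝ (Fin 3) → EuclideanSpace ℝ (Fin 3),
      ContDiff ℝ ∞ U → HasCompactSupport U → VectorCalculus.IsDivFree U →
        ∀ x, ‖fderiv ℝ U x‖ ≤ F ‖curl U x‖) ∧
  (¬ ∃ C r : ℝ, 0 < r ∧ ∀ U : EuclideanSpace ℝ (Fin 3) → EuclideanSpace ℝ (Fin 3),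
      ContDiff ℝ ∞ U → HasCompactSupport U → VectorCalculus.IsDivFree U →
        ∀ (x : EuclideanSpace ℝ (Fin 3)) (M : ℝ), (∀ y, ‖y - x‖ < r → ‖curl U y‖ ≤ M) →
          ‖fderiv ℝ U x‖ ≤ C * M)

/-- The barrier `VorticityStrainNonlocality` holds.
[cite: MajdaBertozziCUP2002, §2.4.1–§2.4.3 Prop. 2.17 (∇v is a singular integral of ω plus a local term)] -/
theorem vorticityStrainNonlocality_holds : VorticityStrainNonlocality :=
  ⟨not_exists_pointwise_gradient_modulus, not_exists_local_gradient_le_vorticity⟩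

/-- `VorticityStrainNonlocality` — `_holds` alias of `vorticityStrainNonlocality_holds` above under the fact's exact name (appended
2026-08-28, D-0026 bookkeeping: the proof term is the existing theorem of this file; no statement,
definition or attribute is edited; no new named fact; the ledger's debt table listed the fact
unproved). [cite: MajdaBertozziCUP2002, §2.4.1–§2.4.3 Prop. 2.17 (∇v is a singular integral of ω plus a local term)] -/
theorem _root_.Literature.Barriers.NavierStokesRegularity.StrainCavity.VorticityStrainNonlocality_holds :
    VorticityStrainNonlocality :=
  _root_.Literature.Barriers.NavierStokesRegularity.StrainCavity.vorticityStrainNonlocality_holds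

end Literature.Barriers.NavierStokesRegularity.StrainCavity

end
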